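import Summits.CriticalPhenomena.Ising3DConformalLimit.Theorems.BallSpecificationBallSpecifiedInversionUpgradeLowOrderClass
import Summits.CriticalPhenomena.Ising3DConformalLimit.Theorems.MarkovRigidityFieldRealisationSmearedLimit
import Summits.CriticalPhenomena.Ising3DConformalLimit.Theorems.MoebiusLimitExists.Negative.MeshContinuity
import Literature.Probability.LatticeModels.CriticalUrsellFourFloor
import Summits.CriticalPhenomena.Ising3DConformalLimit.Theorems.BallSpecificationBallSpecifiedInversionUpgradeFourthMomentPairSplit
import HarnessLib

/-!
# A-priori fourth moments of a field limit of the critical Ising₃ correlators — helper for crux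
# `BallSpecifiedInversionUpgrade` (stmt-CriticalPhenomena-11248), line `birth`

Route `route-CriticalPhenomena-BallSpecification`, sub-problem `Ising3DConformalLimit`.  Target tree file:
`Summits/CriticalPhenomena/Ising3DConformalLimit/Theorems/BallSpecificationBallSpecifiedInversionUpgradeFourthMoment.lean`,
landed with `--supports stmt-CriticalPhenomena-11248` (helper lemmas; no registered stub is claimed).

## Content — the smeared GKS–Lebowitz sandwich for the limit LAW

Under the crux antecedent `H` (only the clauses `hρ`, `hlim`, `hnorm`, `hnd`, `heuc`, `hsc`, `hmomS` are used):
for test functions `f, g`,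

* `∫ (ω f)² (ω g)² dμ = ∫_{(ℝ³)⁴} S 4 (x) f(x₀) f(x₁) g(x₂) g(x₃) dx` (`HasMomentDensity` at `n = 4`), and the
  right-hand side is a GENUINE integral: the four-point function of the limit satisfies the pointwise pinned
  sandwich `0 ≤ S₂(x₀,x₁)S₂(x₂,x₃) ≤ S 4 x ≤ Σ_{pairings} S₂S₂` on non-coincident quadruples (in tree:
  `HasPointwiseScalingLimit.two_mul_two_le_four` = GKS II in the limit, `limitConnectedFour_sandwich` = Lebowitz
  in the limit), the coincident set is Lebesgue-null (`ae_mem_nonCoincident`), and every pairing term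
  `S₂(x_a,x_b)S₂(x_c,x_d) ∏|φᵢ(xᵢ)|` is integrable as a product over disjoint pairs of coordinates of the
  integrable smeared two-point kernels (`S₂ = κ‖·-·‖^(-2Δ)`, `2Δ ≤ 2 < 3`);
* for `0 ≤ f, g`: the SMEARED SANDWICH
  `(∫ (ωf)² dμ)(∫ (ωg)² dμ) ≤ ∫ (ωf)²(ωg)² dμ ≤ (∫ (ωf)² dμ)(∫ (ωg)² dμ) + 2 (∫ S₂ f⊗g)²`,
  i.e. `0 ≤ Cov_μ((ωf)², (ωg)²) ≤ 2⟨f, S₂ g⟩²` (GKS II floor and Lebowitz ceiling of the Ursell function,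
  smeared), and for `0 ≤ f, g` not identically zero `(ωf)²(ωg)²` is `μ`-integrable.

This is the decorrelation input for germ statistics of the field (amplitude law of large numbers on shells),
the first brick of a pinned version of the ball kernels (see the crux notes `Cruxes/…/NOTES-c4.md`, §3 and §5).
References: Glimm–Jaffe, *Quantum Physics* (1987) §6.1; Friedli–Velenik (2017) Thm. 3.20 (GKS);
Lebowitz, Comm. Math. Phys. 35 (1974).  Theorem-only file (no definitions).
-/

noncomputable section

namespace Summit.CriticalPhenomena.Ising3DConformalLimit.BallSpecificationBallSpecifiedInversionUpgrade

open MeasureTheory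
open Literature.Probability.LatticeModels Literature.MathematicalPhysics.QuantumLattice
open Summit.CriticalPhenomena.Ising3DConformalLimit.MarkovRigidityFieldRealisation
open Summit.CriticalPhenomena.Ising3DConformalLimit.InversionUpgradeNormalisedNegative

/-! ### The smeared two-point kernel against two test functions -/

/-- `0 ≤ S 2` everywhere (explicit formula, `κ ≥ 0`). [cite: FrancescoMathieuSenechal1997, §4.3.1] -/
theorem fourthMoment_two_nonneg {Δ : ℝ} {S : CorrFamily 3}
    (hnorm : ∀ n z, z ∉ NonCoincident 3 n → S n z = 0)
    (heuc : IsEuclideanInvariant S) (hsc : IsScaleCovariant Δ S)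
    (hκ : 0 ≤ S 2 ![0, EuclideanSpace.single 0 1]) (y : Fin 2 → (EuclideanSpace ℝ (Fin 3))) : 0 ≤ S 2 y := by
  rw [lowOrderClass_two_point_formula hnorm heuc hsc y]
  split_ifs
  · exact le_rfl
  · exact mul_nonneg hκ (Real.rpow_nonneg (norm_nonneg _) _)

/-- **Integrability of `S₂(y₀,y₁) φ(y₀) ψ(y₁)` on `(ℝ³)²`** for two test functions (`0 ≤ Δ ≤ 1`):
domination by `κ B_φ B_ψ (1+‖y₀‖)^{-4}(1+‖y₁‖)^{-4} max(1,‖y₁-y₀‖^{-2Δ})`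
(`integrable_weight_shift_kernel`), as in `lowOrderClass_integrable_two`. [cite: GlimmJaffe1987, §6.1] -/
theorem fourthMoment_integrable_pair {Δ : ℝ} {S : CorrFamily 3}
    (hnorm : ∀ n z, z ∉ NonCoincident 3 n → S n z = 0)
    (heuc : IsEuclideanInvariant S) (hsc : IsScaleCovariant Δ S)
    (hΔ0 : 0 ≤ Δ) (hΔ1 : Δ ≤ 1) (hκ : 0 ≤ S 2 ![0, EuclideanSpace.single 0 1])
    (φ ψ : SchwartzMap (EuclideanSpace ℝ (Fin 3)) ℝ) :
    Integrable (fun y : Fin 2 → (EuclideanSpace ℝ (Fin 3)) => S 2 y * (φ (y 0) * ψ (y 1))) := by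
  set κ : ℝ := S 2 ![0, EuclideanSpace.single 0 1] with hκdef
  set Bφ : ℝ := 2 ^ 4 * ((Finset.Iic ((4, 0) : ℕ × ℕ)).sup
    (schwartzSeminormFamily ℝ (EuclideanSpace ℝ (Fin 3)) ℝ)) φ with hBφ
  set Bψ : ℝ := 2 ^ 4 * ((Finset.Iic ((4, 0) : ℕ × ℕ)).sup
    (schwartzSeminormFamily ℝ (EuclideanSpace ℝ (Fin 3)) ℝ)) ψ with hBψ
  have hBφ0 : 0 ≤ Bφ := by positivity
  have hBψ0 : 0 ≤ Bψ := by positivity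
  have hφB : ∀ p, |φ p| ≤ Bφ * (1 + ‖p‖) ^ (-(4 : ℝ)) := abs_le_seminorm_mul_weight φ
  have hψB : ∀ p, |ψ p| ≤ Bψ * (1 + ‖p‖) ^ (-(4 : ℝ)) := abs_le_seminorm_mul_weight ψ
  have hdom := (integrable_weight_shift_kernel (a := 2 * Δ) (by positivity) (by linarith)
    (0 : (EuclideanSpace ℝ (Fin 3)))).const_mul (κ * (Bφ * Bψ))
  refine hdom.mono' ?_ (Filter.Eventually.of_forall fun x => ?_)
  · refine ((lowOrderClass_measurable_two hnorm heuc hsc).mul ?_).aestronglyMeasurable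
    exact (φ.continuous.measurable.comp (measurable_pi_apply 0)).mul
      (ψ.continuous.measurable.comp (measurable_pi_apply 1))
  · rw [Real.norm_eq_abs, abs_mul, abs_mul, sub_zero]
    have hmax0 : 0 ≤ max 1 (‖x 1 - x 0‖ ^ (-(2 * Δ))) := le_trans zero_le_one (le_max_left _ _)
    have hA : 0 ≤ κ * max 1 (‖x 1 - x 0‖ ^ (-(2 * Δ))) := mul_nonneg hκ hmax0
    have hS : |S 2 x| ≤ κ * max 1 (‖x 1 - x 0‖ ^ (-(2 * Δ))) := by
      rw [lowOrderClass_two_point_formula hnorm heuc hsc x]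
      split_ifs with h
      · rw [abs_zero]; exact hA
      · rw [abs_of_nonneg (mul_nonneg hκ (Real.rpow_nonneg (norm_nonneg _) _)), norm_sub_rev]
        exact mul_le_mul_of_nonneg_left (le_max_right _ _) hκ
    calc |S 2 x| * (|φ (x 0)| * |ψ (x 1)|)
        ≤ (κ * max 1 (‖x 1 - x 0‖ ^ (-(2 * Δ)))) *
            ((Bφ * (1 + ‖x 0‖) ^ (-(4 : ℝ))) * (Bψ * (1 + ‖x 1‖) ^ (-(4 : ℝ)))) :=
          mul_le_mul hS (mul_le_mul (hφB (x 0)) (hψB (x 1)) (abs_nonneg _)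
            (mul_nonneg hBφ0 (weight_nonneg _ _))) (mul_nonneg (abs_nonneg _) (abs_nonneg _)) hA
      _ = κ * (Bφ * Bψ) * ((1 + ‖x 0‖) ^ (-(4 : ℝ)) * (1 + ‖x 1‖) ^ (-(4 : ℝ)) *
            max 1 (‖x 1 - x 0‖ ^ (-(2 * Δ)))) := by ring

/-- The absolute-value companion: `S₂(y₀,y₁) |φ(y₀)| |ψ(y₁)|` is integrable (it is the norm of the
previous integrand, `S₂ ≥ 0`). [cite: GlimmJaffe1987, §6.1] -/
theorem fourthMoment_integrable_pair_abs {Δ : ℝ} {S : CorrFamily 3}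
    (hnorm : ∀ n z, z ∉ NonCoincident 3 n → S n z = 0)
    (heuc : IsEuclideanInvariant S) (hsc : IsScaleCovariant Δ S)
    (hΔ0 : 0 ≤ Δ) (hΔ1 : Δ ≤ 1) (hκ : 0 ≤ S 2 ![0, EuclideanSpace.single 0 1])
    (φ ψ : SchwartzMap (EuclideanSpace ℝ (Fin 3)) ℝ) :
    Integrable (fun y : Fin 2 → (EuclideanSpace ℝ (Fin 3)) => S 2 y * (|φ (y 0)| * |ψ (y 1)|)) := by
  refine (fourthMoment_integrable_pair hnorm heuc hsc hΔ0 hΔ1 hκ φ ψ).norm.congr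
    (Filter.Eventually.of_forall fun y => ?_)
  show ‖S 2 y * (φ (y 0) * ψ (y 1))‖ = S 2 y * (|φ (y 0)| * |ψ (y 1)|)
  rw [Real.norm_eq_abs, abs_mul, abs_mul,
    abs_of_nonneg (fourthMoment_two_nonneg hnorm heuc hsc hκ y)]

/-! ### The four-point function of the limit: sandwich, measurability, integrability -/

/-- **The pinned sandwich, everywhere**: `0 ≤ S 4 x ≤ S₂(01)S₂(23) + S₂(02)S₂(13) + S₂(03)S₂(12)` for
EVERY `x ∈ (ℝ³)⁴` (GKS I/II and Lebowitz in the limit on non-coincident quadruples —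
`HasPointwiseScalingLimit.two_mul_two_le_four`, `limitConnectedFour_sandwich` — and `S 4 = 0`, `S 2 ≥ 0`
on the coincident ones). [cite: Lebowitz1974, Theorem, eq. (2.5b)] -/
theorem fourthMoment_four_sandwich {ρ : ℝ → ℝ} {Δ : ℝ} {S : CorrFamily 3}
    (hlim : HasPointwiseScalingLimit (criticalCorr 3) ρ S)
    (hnorm : ∀ n z, z ∉ NonCoincident 3 n → S n z = 0)
    (heuc : IsEuclideanInvariant S) (hsc : IsScaleCovariant Δ S)
    (hκ : 0 ≤ S 2 ![0, EuclideanSpace.single 0 1]) (x : Fin 4 → (EuclideanSpace ℝ (Fin 3))) :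
    0 ≤ S 4 x ∧ S 4 x ≤ S 2 ![x 0, x 1] * S 2 ![x 2, x 3] + S 2 ![x 0, x 2] * S 2 ![x 1, x 3]
      + S 2 ![x 0, x 3] * S 2 ![x 1, x 2] := by
  have h2 := fourthMoment_two_nonneg hnorm heuc hsc hκ
  by_cases hx : x ∈ NonCoincident 3 4
  · have hlow := hlim.two_mul_two_le_four le_rfl hx
    have hup := (hlim.limitConnectedFour_sandwich le_rfl hx).2
    simp only [limitConnectedFour] at hup
    exact ⟨le_trans (mul_nonneg (h2 _) (h2 _)) hlow, by linarith⟩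
  · rw [hnorm 4 x hx]
    exact ⟨le_rfl, add_nonneg (add_nonneg (mul_nonneg (h2 _) (h2 _)) (mul_nonneg (h2 _) (h2 _)))
      (mul_nonneg (h2 _) (h2 _))⟩

/-- `S 4` is a.e.-strongly measurable on `(ℝ³)⁴`: it is continuous on the open set of non-coincident
configurations (`continuousOn_limit_of_translationInvariant`) and vanishes off it. [folklore] -/
theorem fourthMoment_four_aestronglyMeasurable {ρ : ℝ → ℝ} {S : CorrFamily 3}
    (hlim : HasPointwiseScalingLimit (criticalCorr 3) ρ S)
    (hnorm : ∀ n z, z ∉ NonCoincident 3 n → S n z = 0) (heuc : IsEuclideanInvariant S) :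
    AEStronglyMeasurable (S 4) (volume : Measure (Fin 4 → (EuclideanSpace ℝ (Fin 3)))) := by
  have hU : MeasurableSet (NonCoincident 3 4) := (isOpen_nonCoincident 3 4).measurableSet
  have hcont : ContinuousOn (S 4) (NonCoincident 3 4) :=
    LimitMeshContinuity.continuousOn_limit_of_translationInvariant hlim heuc.1 4
  have h1 : AEStronglyMeasurable (S 4) ((volume : Measure (Fin 4 → (EuclideanSpace ℝ (Fin 3)))).restrict (NonCoincident 3 4)) :=
    hcont.aestronglyMeasurable hU
  have h2 := (aestronglyMeasurable_indicator_iff hU).2 h1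
  have h3 : (NonCoincident 3 4).indicator (S 4) = S 4 := by
    funext x
    by_cases hx : x ∈ NonCoincident 3 4
    · rw [Set.indicator_of_mem hx]
    · rw [Set.indicator_of_notMem hx, hnorm 4 x hx]
  rwa [h3] at h2

/-- **Integrability of the smeared four-point integrand** `S 4 (x) ∏ᵢ φᵢ(xᵢ)` on `(ℝ³)⁴` for test functions
`φᵢ` (`0 ≤ Δ ≤ 1`): dominate by the three pairing terms, each an integrable product over disjoint pairs
of coordinates. [cite: GlimmJaffe1987, §6.1] -/
theorem fourthMoment_integrable_four {ρ : ℝ → ℝ} {Δ : ℝ} {S : CorrFamily 3}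
    (hlim : HasPointwiseScalingLimit (criticalCorr 3) ρ S)
    (hnorm : ∀ n z, z ∉ NonCoincident 3 n → S n z = 0)
    (heuc : IsEuclideanInvariant S) (hsc : IsScaleCovariant Δ S)
    (hΔ0 : 0 ≤ Δ) (hΔ1 : Δ ≤ 1) (hκ : 0 ≤ S 2 ![0, EuclideanSpace.single 0 1])
    (φ : Fin 4 → SchwartzMap (EuclideanSpace ℝ (Fin 3)) ℝ) :
    Integrable (fun x : Fin 4 → (EuclideanSpace ℝ (Fin 3)) => S 4 x * ∏ i, φ i (x i)) := by
  -- the three integrable pairing dominators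
  have hP := fun a b => fourthMoment_integrable_pair_abs hnorm heuc hsc hΔ0 hΔ1 hκ (φ a) (φ b)
  have h01 := fourthMoment_integrable_split01 (hP 0 1) (hP 2 3)
  have h02 := fourthMoment_integrable_split02 (hP 0 2) (hP 1 3)
  have h03 := fourthMoment_integrable_split03 (hP 0 3) (hP 1 2)
  have hdom := (h01.add h02).add h03
  refine hdom.mono' ?_ (Filter.Eventually.of_forall fun x => ?_)
  · refine (fourthMoment_four_aestronglyMeasurable hlim hnorm heuc).mul ?_
    exact (Finset.measurable_prod _ fun i _ =>
      (φ i).continuous.measurable.comp (measurable_pi_apply i)).aestronglyMeasurable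
  · have hsw := fourthMoment_four_sandwich hlim hnorm heuc hsc hκ x
    have h2 := fourthMoment_two_nonneg hnorm heuc hsc hκ
    rw [Real.norm_eq_abs, abs_mul, abs_of_nonneg hsw.1, Fin.prod_univ_four, abs_mul, abs_mul, abs_mul]
    simp only [Pi.add_apply, Matrix.cons_val_zero, Matrix.cons_val_one]
    have hA : 0 ≤ |φ 0 (x 0)| * |φ 1 (x 1)| * |φ 2 (x 2)| * |φ 3 (x 3)| := by positivity
    calc S 4 x * (|φ 0 (x 0)| * |φ 1 (x 1)| * |φ 2 (x 2)| * |φ 3 (x 3)|)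
        ≤ (S 2 ![x 0, x 1] * S 2 ![x 2, x 3] + S 2 ![x 0, x 2] * S 2 ![x 1, x 3]
            + S 2 ![x 0, x 3] * S 2 ![x 1, x 2]) *
            (|φ 0 (x 0)| * |φ 1 (x 1)| * |φ 2 (x 2)| * |φ 3 (x 3)|) :=
          mul_le_mul_of_nonneg_right hsw.2 hA
      _ = S 2 ![x 0, x 1] * (|φ 0 (x 0)| * |φ 1 (x 1)|) * (S 2 ![x 2, x 3] * (|φ 2 (x 2)| * |φ 3 (x 3)|))
          + S 2 ![x 0, x 2] * (|φ 0 (x 0)| * |φ 2 (x 2)|) * (S 2 ![x 1, x 3] * (|φ 1 (x 1)| * |φ 3 (x 3)|))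
          + S 2 ![x 0, x 3] * (|φ 0 (x 0)| * |φ 3 (x 3)|) * (S 2 ![x 1, x 2] * (|φ 1 (x 1)| * |φ 2 (x 2)|)) := by
          ring
      _ = _ := by rfl

/-! ### Fourth moments of the law -/

/-- **`HasMomentDensity` at `n = 4`**: `∫ (ωf)²(ωg)² dμ = ∫ S 4 (x) f(x₀)f(x₁)g(x₂)g(x₃) dx` (both sides junk
`0` simultaneously). [cite: OsterwalderSchrader1973, §2] -/
theorem fourthMoment_integral_sq_mul_sq_eq {S : CorrFamily 3}
    {μ : Measure (FieldConfig (EuclideanSpace ℝ (Fin 3)))} (hmomS : HasMomentDensity μ S) (f g : SchwartzMap (EuclideanSpace ℝ (Fin 3)) ℝ) :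
    ∫ ω : FieldConfig (EuclideanSpace ℝ (Fin 3)), (ω f) ^ 2 * (ω g) ^ 2 ∂μ =
      ∫ x : Fin 4 → (EuclideanSpace ℝ (Fin 3)), S 4 x * (f (x 0) * f (x 1) * g (x 2) * g (x 3)) := by
  have h := hmomS 4 ![f, f, g, g]
  simp only [moment, Fin.prod_univ_four] at h
  have hl : (fun ω : FieldConfig (EuclideanSpace ℝ (Fin 3)) => (ω f) ^ 2 * (ω g) ^ 2) = fun ω : FieldConfig (EuclideanSpace ℝ (Fin 3)) =>
      ω ((![f, f, g, g] : Fin 4 → SchwartzMap (EuclideanSpace ℝ (Fin 3)) ℝ) 0) * ω ((![f, f, g, g] : Fin 4 → SchwartzMap (EuclideanSpace ℝ (Fin 3)) ℝ) 1) *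
        ω ((![f, f, g, g] : Fin 4 → SchwartzMap (EuclideanSpace ℝ (Fin 3)) ℝ) 2) * ω ((![f, f, g, g] : Fin 4 → SchwartzMap (EuclideanSpace ℝ (Fin 3)) ℝ) 3) := by
    funext ω
    change (ω f) ^ 2 * (ω g) ^ 2 = ω f * ω f * ω g * ω g
    ring
  rw [hl, h]
  rfl

/-- Second moments through the density, product form: `∫ (ω φ)(ω ψ)… = ∫ S 2 (y) φ(y₀) ψ(y₁) dy` — here only the
diagonal case `∫ (ω φ)² dμ = ∫ S 2 (y) φ(y₀) φ(y₁) dy`. [cite: OsterwalderSchrader1973, §2] -/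
theorem fourthMoment_integral_sq_eq' {S : CorrFamily 3}
    {μ : Measure (FieldConfig (EuclideanSpace ℝ (Fin 3)))} (hmomS : HasMomentDensity μ S) (φ : SchwartzMap (EuclideanSpace ℝ (Fin 3)) ℝ) :
    ∫ ω : FieldConfig (EuclideanSpace ℝ (Fin 3)), (ω φ) ^ 2 ∂μ = ∫ y : Fin 2 → (EuclideanSpace ℝ (Fin 3)), S 2 y * (φ (y 0) * φ (y 1)) := by
  rw [lowOrderClass_integral_sq_eq hmomS φ]
  congr 1
  funext y
  rw [Fin.prod_univ_two]

/-- **The smeared GKS–Lebowitz sandwich for the limit law.**  For `0 ≤ f, g`: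
`(∫ (ωf)² dμ)(∫ (ωg)² dμ) ≤ ∫ (ωf)²(ωg)² dμ ≤ (∫ (ωf)² dμ)(∫ (ωg)² dμ) + 2 (∫ S₂(y) f(y₀) g(y₁) dy)²`, i.e.
`0 ≤ Cov_μ((ωf)², (ωg)²) ≤ 2 ⟨f, S₂ g⟩²`.  (Pointwise `S₂(01)S₂(23) ≤ S 4` a.e. and
`S 4 ≤ Σ_{pairings} S₂S₂` everywhere, integrated against `f⊗²⊗g⊗² ≥ 0`; the pairing integrals factorise.)
[cite: Lebowitz1974, Theorem, eq. (2.5b)] -/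
theorem fourthMoment_sandwich {ρ : ℝ → ℝ} {Δ : ℝ} {S : CorrFamily 3}
    {μ : Measure (FieldConfig (EuclideanSpace ℝ (Fin 3)))}
    (hlim : HasPointwiseScalingLimit (criticalCorr 3) ρ S)
    (hnorm : ∀ n z, z ∉ NonCoincident 3 n → S n z = 0)
    (heuc : IsEuclideanInvariant S) (hsc : IsScaleCovariant Δ S)
    (hΔ0 : 0 ≤ Δ) (hΔ1 : Δ ≤ 1) (hκ : 0 ≤ S 2 ![0, EuclideanSpace.single 0 1])
    (hmomS : HasMomentDensity μ S)
    {f g : SchwartzMap (EuclideanSpace ℝ (Fin 3)) ℝ} (hf0 : ∀ p, 0 ≤ f p) (hg0 : ∀ p, 0 ≤ g p) :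
    (∫ ω : FieldConfig (EuclideanSpace ℝ (Fin 3)), (ω f) ^ 2 ∂μ) * (∫ ω : FieldConfig (EuclideanSpace ℝ (Fin 3)), (ω g) ^ 2 ∂μ) ≤
        ∫ ω : FieldConfig (EuclideanSpace ℝ (Fin 3)), (ω f) ^ 2 * (ω g) ^ 2 ∂μ ∧
      ∫ ω : FieldConfig (EuclideanSpace ℝ (Fin 3)), (ω f) ^ 2 * (ω g) ^ 2 ∂μ ≤
        (∫ ω : FieldConfig (EuclideanSpace ℝ (Fin 3)), (ω f) ^ 2 ∂μ) * (∫ ω : FieldConfig (EuclideanSpace ℝ (Fin 3)), (ω g) ^ 2 ∂μ) +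
          2 * (∫ y : Fin 2 → (EuclideanSpace ℝ (Fin 3)), S 2 y * (f (y 0) * g (y 1))) ^ 2 := by
  -- densities
  set Hff : (Fin 2 → (EuclideanSpace ℝ (Fin 3))) → ℝ := fun y => S 2 y * (f (y 0) * f (y 1)) with hHff
  set Hgg : (Fin 2 → (EuclideanSpace ℝ (Fin 3))) → ℝ := fun y => S 2 y * (g (y 0) * g (y 1)) with hHgg
  set Hfg : (Fin 2 → (EuclideanSpace ℝ (Fin 3))) → ℝ := fun y => S 2 y * (f (y 0) * g (y 1)) with hHfg
  have iff := fourthMoment_integrable_pair hnorm heuc hsc hΔ0 hΔ1 hκ f f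
  have igg := fourthMoment_integrable_pair hnorm heuc hsc hΔ0 hΔ1 hκ g g
  have ifg := fourthMoment_integrable_pair hnorm heuc hsc hΔ0 hΔ1 hκ f g
  have h2 := fourthMoment_two_nonneg hnorm heuc hsc hκ
  rw [fourthMoment_integral_sq_eq' hmomS f, fourthMoment_integral_sq_eq' hmomS g,
    fourthMoment_integral_sq_mul_sq_eq hmomS f g]
  have i4 : Integrable (fun x : Fin 4 → (EuclideanSpace ℝ (Fin 3)) => S 4 x * (f (x 0) * f (x 1) * g (x 2) * g (x 3))) := by
    have := fourthMoment_integrable_four hlim hnorm heuc hsc hΔ0 hΔ1 hκ ![f, f, g, g]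
    refine this.congr (Filter.Eventually.of_forall fun x => ?_)
    simp only [Fin.prod_univ_four]
    rfl
  -- the three pairing integrals
  have e01 : ∫ x : Fin 4 → (EuclideanSpace ℝ (Fin 3)), Hff ![x 0, x 1] * Hgg ![x 2, x 3] = (∫ y, Hff y) * (∫ z, Hgg z) :=
    fourthMoment_integral_split01 Hff Hgg
  have e02 : ∫ x : Fin 4 → (EuclideanSpace ℝ (Fin 3)), Hfg ![x 0, x 2] * Hfg ![x 1, x 3] = (∫ y, Hfg y) * (∫ z, Hfg z) :=
    fourthMoment_integral_split02 Hfg Hfg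
  have e03 : ∫ x : Fin 4 → (EuclideanSpace ℝ (Fin 3)), Hfg ![x 0, x 3] * Hfg ![x 1, x 2] = (∫ y, Hfg y) * (∫ z, Hfg z) :=
    fourthMoment_integral_split03 Hfg Hfg
  have i01 : Integrable (fun x : Fin 4 → (EuclideanSpace ℝ (Fin 3)) => Hff ![x 0, x 1] * Hgg ![x 2, x 3]) :=
    fourthMoment_integrable_split01 iff igg
  have i02 : Integrable (fun x : Fin 4 → (EuclideanSpace ℝ (Fin 3)) => Hfg ![x 0, x 2] * Hfg ![x 1, x 3]) :=
    fourthMoment_integrable_split02 ifg ifg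
  have i03 : Integrable (fun x : Fin 4 → (EuclideanSpace ℝ (Fin 3)) => Hfg ![x 0, x 3] * Hfg ![x 1, x 2]) :=
    fourthMoment_integrable_split03 ifg ifg
  -- pointwise identities for the pairing integrands
  have p01 : ∀ x : Fin 4 → (EuclideanSpace ℝ (Fin 3)), Hff ![x 0, x 1] * Hgg ![x 2, x 3] =
      S 2 ![x 0, x 1] * S 2 ![x 2, x 3] * (f (x 0) * f (x 1) * g (x 2) * g (x 3)) := fun x => by
    simp only [hHff, hHgg, Matrix.cons_val_zero, Matrix.cons_val_one]; ring
  have p02 : ∀ x : Fin 4 → (EuclideanSpace ℝ (Fin 3)), Hfg ![x 0, x 2] * Hfg ![x 1, x 3] =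
      S 2 ![x 0, x 2] * S 2 ![x 1, x 3] * (f (x 0) * f (x 1) * g (x 2) * g (x 3)) := fun x => by
    simp only [hHfg, Matrix.cons_val_zero, Matrix.cons_val_one]; ring
  have p03 : ∀ x : Fin 4 → (EuclideanSpace ℝ (Fin 3)), Hfg ![x 0, x 3] * Hfg ![x 1, x 2] =
      S 2 ![x 0, x 3] * S 2 ![x 1, x 2] * (f (x 0) * f (x 1) * g (x 2) * g (x 3)) := fun x => by
    simp only [hHfg, Matrix.cons_val_zero, Matrix.cons_val_one]; ring
  have hF0 : ∀ x : Fin 4 → (EuclideanSpace ℝ (Fin 3)), 0 ≤ f (x 0) * f (x 1) * g (x 2) * g (x 3) := fun x =>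
    mul_nonneg (mul_nonneg (mul_nonneg (hf0 _) (hf0 _)) (hg0 _)) (hg0 _)
  constructor
  · -- lower bound: GKS II a.e.
    rw [← e01]
    refine integral_mono_ae i01 i4 ?_
    filter_upwards [ae_mem_nonCoincident 4] with x hx
    rw [p01 x]
    exact mul_le_mul_of_nonneg_right (hlim.two_mul_two_le_four le_rfl hx) (hF0 x)
  · -- upper bound: Lebowitz everywhere
    have hle : ∫ x : Fin 4 → (EuclideanSpace ℝ (Fin 3)), S 4 x * (f (x 0) * f (x 1) * g (x 2) * g (x 3)) ≤
        ∫ x : Fin 4 → (EuclideanSpace ℝ (Fin 3)), (Hff ![x 0, x 1] * Hgg ![x 2, x 3] + Hfg ![x 0, x 2] * Hfg ![x 1, x 3]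
          + Hfg ![x 0, x 3] * Hfg ![x 1, x 2]) := by
      refine integral_mono i4 ((i01.add i02).add i03) fun x => ?_
      have hsw := fourthMoment_four_sandwich hlim hnorm heuc hsc hκ x
      show S 4 x * (f (x 0) * f (x 1) * g (x 2) * g (x 3)) ≤ Hff ![x 0, x 1] * Hgg ![x 2, x 3]
        + Hfg ![x 0, x 2] * Hfg ![x 1, x 3] + Hfg ![x 0, x 3] * Hfg ![x 1, x 2]
      rw [p01 x, p02 x, p03 x, ← add_mul, ← add_mul]
      exact mul_le_mul_of_nonneg_right hsw.2 (hF0 x)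
    refine hle.trans (le_of_eq ?_)
    have eq1 : ∫ x : Fin 4 → (EuclideanSpace ℝ (Fin 3)), (Hff ![x 0, x 1] * Hgg ![x 2, x 3] + Hfg ![x 0, x 2] * Hfg ![x 1, x 3]
          + Hfg ![x 0, x 3] * Hfg ![x 1, x 2]) =
        (∫ x : Fin 4 → (EuclideanSpace ℝ (Fin 3)), (Hff ![x 0, x 1] * Hgg ![x 2, x 3] + Hfg ![x 0, x 2] * Hfg ![x 1, x 3])) +
          ∫ x : Fin 4 → (EuclideanSpace ℝ (Fin 3)), Hfg ![x 0, x 3] * Hfg ![x 1, x 2] := integral_add (i01.add i02) i03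
    have eq2 : ∫ x : Fin 4 → (EuclideanSpace ℝ (Fin 3)), (Hff ![x 0, x 1] * Hgg ![x 2, x 3] + Hfg ![x 0, x 2] * Hfg ![x 1, x 3]) =
        (∫ x : Fin 4 → (EuclideanSpace ℝ (Fin 3)), Hff ![x 0, x 1] * Hgg ![x 2, x 3]) +
          ∫ x : Fin 4 → (EuclideanSpace ℝ (Fin 3)), Hfg ![x 0, x 2] * Hfg ![x 1, x 3] := integral_add i01 i02
    rw [eq1, eq2, e01, e02, e03]
    ring

/-- **Integrability of `(ωf)²(ωg)²`** for nonnegative, not identically zero test functions `f, g`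
(`κ > 0`): the fourth moment `∫ (ωf)²(ωg)² dμ ≥ (∫ (ωf)² dμ)(∫ (ωg)² dμ) > 0` is a NON-ZERO Bochner
integral, hence a genuine one. [cite: GlimmJaffe1987, §6.1] -/
theorem fourthMoment_integrable_sq_mul_sq {ρ : ℝ → ℝ} {Δ : ℝ} {S : CorrFamily 3}
    {μ : Measure (FieldConfig (EuclideanSpace ℝ (Fin 3)))}
    (hlim : HasPointwiseScalingLimit (criticalCorr 3) ρ S)
    (hnorm : ∀ n z, z ∉ NonCoincident 3 n → S n z = 0)
    (heuc : IsEuclideanInvariant S) (hsc : IsScaleCovariant Δ S)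
    (hΔ0 : 0 ≤ Δ) (hΔ1 : Δ ≤ 1) (hκ : 0 < S 2 ![0, EuclideanSpace.single 0 1])
    (hmomS : HasMomentDensity μ S)
    {f g : SchwartzMap (EuclideanSpace ℝ (Fin 3)) ℝ} (hf0 : ∀ p, 0 ≤ f p) (hg0 : ∀ p, 0 ≤ g p)
    {p₀ q₀ : (EuclideanSpace ℝ (Fin 3))} (hfp : f p₀ ≠ 0) (hgq : g q₀ ≠ 0) :
    Integrable (fun ω : FieldConfig (EuclideanSpace ℝ (Fin 3)) => (ω f) ^ 2 * (ω g) ^ 2) μ := by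
  have hsw := (fourthMoment_sandwich hlim hnorm heuc hsc hΔ0 hΔ1 hκ.le hmomS hf0 hg0).1
  have hf2 : 0 < ∫ ω : FieldConfig (EuclideanSpace ℝ (Fin 3)), (ω f) ^ 2 ∂μ := by
    rw [lowOrderClass_integral_sq_eq hmomS f]
    exact lowOrderClass_integral_pos hnorm heuc hsc hΔ0 hΔ1 hκ hf0 hfp
  have hg2 : 0 < ∫ ω : FieldConfig (EuclideanSpace ℝ (Fin 3)), (ω g) ^ 2 ∂μ := by
    rw [lowOrderClass_integral_sq_eq hmomS g]
    exact lowOrderClass_integral_pos hnorm heuc hsc hΔ0 hΔ1 hκ hg0 hgq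
  have hne : (∫ ω : FieldConfig (EuclideanSpace ℝ (Fin 3)), (ω f) ^ 2 * (ω g) ^ 2 ∂μ) ≠ 0 :=
    ne_of_gt (lt_of_lt_of_le (mul_pos hf2 hg2) hsw)
  by_contra hni
  exact hne (integral_undef hni)

/-! ### Packaging under the crux antecedent `H` -/

/-- **A-priori fourth-moment structure of any tuple satisfying the crux antecedent `H`** of
`BallSpecifiedInversionUpgrade` (stmt-CriticalPhenomena-11248): (1) `∫ (ωf)²(ωg)² dμ` is the `S 4`-integral;
(2) the smeared GKS–Lebowitz sandwich `0 ≤ Cov_μ((ωf)²,(ωg)²) ≤ 2⟨f, S₂ g⟩²` for `0 ≤ f, g`;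
(3) `(ωf)²(ωg)² ∈ L¹(μ)` for `0 ≤ f, g` not identically zero.  Helper (`--supports`) for the line `birth`:
the decorrelation input of the amplitude germ statistic of a pinned version (crux notes NOTES-c4 §3, §5).
[cite: Lebowitz1974, Theorem, eq. (2.5b)] [cite: FriedliVelenik2017, Thm. 3.20] -/
theorem fourthMoment_of_hyp :
    ∀ (ρ : ℝ → ℝ) (Δ : ℝ) (S : Literature.Probability.LatticeModels.CorrFamily 3) (L : ℝ → ℕ) (μ : MeasureTheory.Measure (Literature.MathematicalPhysics.QuantumLattice.FieldConfig (EuclideanSpace ℝ (Fin 3)))) (γ : EuclideanSpace ℝ (Fin 3) → ℝ → Literature.MathematicalPhysics.QuantumLattice.FieldConfig (EuclideanSpace ℝ (Fin 3)) → MeasureTheory.Measure (Literature.MathematicalPhysics.QuantumLattice.FieldConfig (EuclideanSpace ℝ (Fin 3)))), ((∀ δ ∈ Set.Ioc (0:ℝ) 1, 0 < ρ δ) ∧ 0 < Δ ∧ Literature.Probability.LatticeModels.HasPointwiseScalingLimit (Literature.Probability.LatticeModels.criticalCorr 3) ρ S ∧ (∀ n z, z ∉ Literature.Probability.LatticeModels.NonCoincident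 3 n → S n z = 0) ∧ Literature.Probability.LatticeModels.IsNondegenerateTwoPoint S ∧ Literature.Probability.LatticeModels.IsEuclideanInvariant S ∧ Literature.Probability.LatticeModels.IsScaleCovariant Δ S ∧ Filter.Tendsto (fun δ : ℝ => δ * L δ) (nhdsWithin 0 (Set.Ioi 0)) Filter.atTop ∧ Literature.MathematicalPhysics.QuantumLattice.TendstoInLaw (fun δ => Literature.MathematicalPhysics.QuantumLattice.spinFieldLaw (Literature.Probability.LatticeModels.isingMeasure (Literature.Probability.LatticeModels.zdGraph 3) (Literature.Probability.LatticeModels.box 3 (L δ)) (Literature.Probability.LatticeModels.criticalBeta 3) 0 Literature.Probability.LatticeModels.BoundaryCondition.plus) (Literature.Probability.LatticeModels.box 3 (L δ)) δ (ρ δ)) (nhdsWithin 0 (Set.Ioi 0)) μ ∧ Literature.MathematicalPhysics.QuantumLattice.HasMomentDensity μ S ∧ Literature.MathematicalPhysics.QuantumLattice.IsEuclideanInvariantLaw μ ∧ (∀ (s : ℝ) (hs : 0 < s), MeasureTheory.Measure.map (Literature.MathematicalPhysics.QuantumLattice.FieldConfig.act ((s ^ (Δ - 3)) • Literature.MathematicalPhysics.QuantumLattice.dilateTest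 s hs.ne')) μ = μ) ∧ (∀ c r, 0 < r → ∀ η, MeasureTheory.IsProbabilityMeasure (γ c r η)) ∧ (∀ c r, 0 < r → ∀ A, MeasurableSet A → Measurable[Literature.MathematicalPhysics.QuantumLattice.extEvents (Metric.closedBall c r)ᶜ] (fun η => γ c r η A)) ∧ (∀ c r, 0 < r → ∀ A, MeasurableSet[Literature.MathematicalPhysics.QuantumLattice.extEvents (Metric.ball c r)] A → Measurable[Literature.MathematicalPhysics.QuantumLattice.germEvents c r] (fun η => γ c r η A)) ∧ (∀ c r, 0 < r → ∀ η, ∀ᵐ ω ∂(γ c r η), ∀ f : SchwartzMap (EuclideanSpace ℝ (Fin 3)) ℝ, tsupport (f : EuclideanSpace ℝ (Fin 3) → ℝ) ⊆ (Metric.closedBall c r)ᶜ → ω f = η f) ∧ Literature.MathematicalPhysics.QuantumLattice.IsGibbsFor γ μ Set.univ) → (∀ f g : SchwartzMap (EuclideanSpace ℝ (Fin 3)) ℝ, ∫ ω, (ω f) ^ 2 * (ω g) ^ 2 ∂μ = ∫ x : Fin 4 → EuclideanSpace ℝ (Fin 3), S 4 x * (f (x 0) * f (x 1) * g (x 2)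 * g (x 3))) ∧ (∀ f g : SchwartzMap (EuclideanSpace ℝ (Fin 3)) ℝ, (∀ p, 0 ≤ f p) → (∀ p, 0 ≤ g p) → (∫ ω, (ω f) ^ 2 ∂μ) * (∫ ω, (ω g) ^ 2 ∂μ) ≤ ∫ ω, (ω f) ^ 2 * (ω g) ^ 2 ∂μ ∧ ∫ ω, (ω f) ^ 2 * (ω g) ^ 2 ∂μ ≤ (∫ ω, (ω f) ^ 2 ∂μ) * (∫ ω, (ω g) ^ 2 ∂μ) + 2 * (∫ y : Fin 2 → EuclideanSpace ℝ (Fin 3), S 2 y * (f (y 0) * g (y 1))) ^ 2) ∧ (∀ (f g : SchwartzMap (EuclideanSpace ℝ (Fin 3)) ℝ) (p₀ q₀ : EuclideanSpace ℝ (Fin 3)), (∀ p, 0 ≤ f p) → (∀ p, 0 ≤ g p) → f p₀ ≠ 0 → g q₀ ≠ 0 → MeasureTheory.Integrable (fun ω : Literature.MathematicalPhysics.QuantumLattice.FieldConfig (EuclideanSpace ℝ (Fin 3)) => (ω f) ^ 2 * (ω g) ^ 2) μ) := by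
  intro ρ Δ S L μ γ hH
  obtain ⟨hρ, -, hlim, hnorm, hnd, heuc, hsc, -, -, hmomS, -⟩ := hH
  have hwin := delta_mem_Icc_of_hyp hρ hlim hnd hsc
  have hΔ0 : 0 ≤ Δ := by linarith [hwin.1]
  have hκ : 0 < S 2 ![0, EuclideanSpace.single 0 1] :=
    hnd _ (zero_unitVec_mem_nonCoincident one_ne_zero)
  exact ⟨fun f g => fourthMoment_integral_sq_mul_sq_eq hmomS f g,
    fun f g hf0 hg0 => fourthMoment_sandwich hlim hnorm heuc hsc hΔ0 hwin.2 hκ.le hmomS hf0 hg0,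
    fun f g p₀ q₀ hf0 hg0 hfp hgq =>
      fourthMoment_integrable_sq_mul_sq hlim hnorm heuc hsc hΔ0 hwin.2 hκ hmomS hf0 hg0 hfp hgq⟩

end Summit.CriticalPhenomena.Ising3DConformalLimit.BallSpecificationBallSpecifiedInversionUpgrade

end
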